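import Summits.QuantumFields.BalabanUV.Beta.GAN24.TaylorTrilinearDiff
import Summits.QuantumFields.BalabanUV.Beta.GAN24.TaylorRowW

/-!
# `BalabanUV.Beta.GAN24.TaylorRowDW` — binder row G-an2-4 ∕ (CONV-C), S-slot, road «S3-Taylor»: THE DIFF ROW R3-dW OF THE RATE
# TABLE «E3SupRate», REDUCED IN THE KERNEL TO THE LOCATED INPUT «(N1-Cauchy)» (`rowDW_of_cauchy`, `d = 3`, `Lc ≥ 2`)

G-an2-4 formalisation swarm, leaf prover 15 (unit `b2b-balaban-gan24-formalise-leaf-15`, gen 14; DIFF row R3-dW holder — LEAVES.md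
PART III § III.R, INTENT CLAIMS.log l.4908).  NOT IN PRINT; OUR PROOF ATTEMPT.  HONEST FRAMING (cell rule, verbatim): «discharging
`BetaPertH` makes Bałaban's UV stability UNCONDITIONAL — a real constructive-QFT result; it is NOT the continuum limit and NOT the
Clay problem.»  HONEST DEPENDENCY (verbatim): «continuum YM on T⁴ ⇐ BetaPertH ∧ nine spine estimates (0/9 proved); BetaPertH ⇐
(D1) ∧ (D4) ∧ CAP+tail; G-an2-4 gates asym, D1 and NE2/3/4.»  [folklore] bookkeeping over an2's DEFINITIONS (`e3OfS`, `wilsonA`, `wH`,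
`GamΦ` BY NAME); no cited fact, no `def … : Prop`; the analytic inputs are (N1) ∧ (N1′) BY NAME (tree) and «(N1-Cauchy)» AS A
HYPOTHESIS (OPEN — typer row T-N1C, owner's `N1-CAUCHY-SPEC.md`).  Discharges NOTHING of (hS, hSall) ∕ «E3SupRate» by itself (one of
twelve analytic rows, and conditional); NOT BetaPertH, NOT continuum, NOT Clay.

## What is proved (`0 sorry`)
* §1 `wEntry_tinv`, **`wilsonA_tinv`** (translation invariance of the Wilson table = (hTinv) of `trilinear_diff_bound`), `natl1_le_of_mem_box1`.
* §2 **`abs_wilson_diff_entry_le`** (`d = 3`): `e3W_unit_split` at both members, then `trilinear_diff_bound (Lc^(n+2)) Lc (Lc^(n+3))` with the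
  legs∕table∕box of `TaylorRowW.locStencil_wilson_piece` (W1 `wilsonA_sum_zero_offsets`, `GamΦ_eq_neg_wH`, `quo_sub_zsmul` BY NAME).
* §3 `geom_pack`, **`rowDW_of_fineReadout`** (`∃ cW θ, 0 ≤ θ < 1 ∧ dW`, `θ = max θ_C Lc⁻¹`), `weaken_rate`,
  **`rowDW_of_cauchy`** ((N1) ∧ (N1′) BY NAME; ONLY the pointwise-sample «(N1-Cauchy)» remains), `l1_red_le`, **`rowDW_of_sampleCauchy`**
  (socket for leaf-19's sample form (P) of `FineReadoutCauchyDecLegs`).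
NOT HERE: «(N1-Cauchy)» itself (T-N1C); the other DIFF rows; the RATE END (tree).
-/

noncomputable section

open Finset
open scoped BigOperators
open Literature.MathematicalPhysics.QuantumFieldTheory Balaban1983to89 Balaban1983to89.Beta
open B12Sec2to5 (l1 l1_nonneg)
open ExpKernelCalculus (MKer Zl)
open OneStepResolventKernel (Fib LocStencil)
open LatticeForm (quo)
open KernelSpecInstance (wH)
open KKTFluctuationKernel (GamΦ)
open ResolventComposition (GamΦ_eq_neg_wH)
open StepJetData (wEntry wilsonA wBound wBound_nonneg)
open BalabanStepJets (box1 mem_box1 l1_le_of_mem_box1)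
open BlochFibreUniqueness (quo_add_zsmul)
open Summit.QuantumFields.BalabanUV.Beta.GAN24.E3UnitSplit (e3OfS e3W_unit_split e3OfS_inl_inr e3OfS_inr)
open Summit.QuantumFields.BalabanUV.Beta.GAN24.WilsonVertexSumZero (wEntry_eq_sum)
open Summit.QuantumFields.BalabanUV.Beta.GAN24.CombesThomas (SupBound)
open Summit.QuantumFields.BalabanUV.Beta.GAN24.CombesThomasFibre (quo_sub_zsmul)
open Summit.QuantumFields.BalabanUV.Beta.GAN24.TaylorRowW (abs_wilsonA_le wilsonA_eq_zero_of_left wilsonA_eq_zero_of_right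
  wilsonA_sum_zero_offsets)
open Summit.QuantumFields.BalabanUV.Beta.GAN24.TaylorTrilinearDiff (trilinear_diff_bound)

namespace Summit.QuantumFields.BalabanUV.Beta.GAN24.TaylorRowDW

variable {d : ℕ}

/-! ## §1 The Wilson table is translation invariant in the vertex location -/

/-- [folklore] The one-plaquette entries depend on the two leg sites only through their offsets from the vertex location. -/
theorem wEntry_tinv (κ' : Fin (d + 1)) (v s t : Fin (d + 1) → ℤ) (α β : Fin (d + 1)) :
    wEntry d κ' v (v + s) (v + t) α β = wEntry d κ' 0 s t α β := by
  rw [wEntry_eq_sum, wEntry_eq_sum]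
  refine Finset.sum_congr rfl fun i _ => ?_
  simp only [zero_add, add_right_inj]

/-- [folklore] **TRANSLATION INVARIANCE OF THE WILSON TABLE** (the hypothesis (hTinv) of `TaylorTrilinearDiff.trilinear_diff_bound`):
`wilsonA d κ v (v+s) (v+t) (inl l) (inl l′) = wilsonA d κ 0 s t (inl l) (inl l′)`. -/
theorem wilsonA_tinv (κ : Fin (d + 1)) (v s t : Fin (d + 1) → ℤ) (l l' : Fin (d + 1)) :
    wilsonA d κ v (v + s) (v + t) (Sum.inl l) (Sum.inl l') = wilsonA d κ 0 s t (Sum.inl l) (Sum.inl l') := by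
  show 1 / 2 * (wEntry d κ v (v + s) (v + t) l l' - wEntry d κ v (v + t) (v + s) l' l) =
    1 / 2 * (wEntry d κ 0 s t l l' - wEntry d κ 0 t s l' l)
  rw [wEntry_tinv, wEntry_tinv]

/-- [folklore] Offsets in the box have `ℕ`-valued `ℓ¹` size at most `D`. -/
theorem natl1_le_of_mem_box1 {D : ℕ} {v : Fin D → ℤ} (hv : v ∈ box1 D) : LatticeForm.l1 v ≤ D := by
  rw [mem_box1] at hv
  unfold LatticeForm.l1
  calc ∑ i, (v i).natAbs ≤ ∑ _i : Fin D, 1 := Finset.sum_le_sum fun i _ => by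
        rcases hv i with h | h | h <;> simp [h]
    _ = D := by simp

/-! ## §2 Row dW at `d = 3`, modulo (N1) ∕ (N1′) ∕ (N1-Cauchy) in the adopted block-label `ℓ¹` currency -/

section Row

variable {Lc : ℕ} [NeZero Lc]

/-- [folklore] **THE WILSON DIFFERENCE, ONE ENTRY** (`d = 3`; members `n+3` vs `n+2`): under (N1), (N1′) and the POINTWISE-SAMPLE
coupling «(N1-Cauchy)» (block-label `ℓ¹` currency, uniform in the level), every entry of the row-dW family is
`≤ |cE/Lc⁴|·P·(c_C θ_C^{n+1}·X_I + Lc^{−(n+2)}·X_II)`, `P = 4³·81²·wBound 3·Zl 4 (δ/2)` — `TaylorTrilinearDiff.trilinear_diff_bound`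
at the instantiation of `E3UnitSplit.e3W_unit_split` (residual `N^{d−3} = 1` at both members). -/
theorem abs_wilson_diff_entry_le (cE : ℝ) {δ CH CH' cC θC : ℝ} (hδ : 0 < δ) (hCH' : 0 ≤ CH') (hcC : 0 ≤ cC) (hθC : 0 ≤ θC)
    (hN1 : ∀ (j : ℕ) (κ l : Fin (3 + 1)) (z : Fin (3 + 1) → ℤ),
      |((Lc : ℝ) ^ (j + 1)) ^ (3 + 2) * wH (N := Lc ^ (j + 1)) κ l z| ≤ CH * Real.exp (-δ * l1 (quo (Lc ^ (j + 1)) z)))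
    (hN1' : ∀ (j : ℕ) (κ l : Fin (3 + 1)) (z : Fin (3 + 1) → ℤ) (ν : Fin (3 + 1)),
      |((Lc : ℝ) ^ (j + 1)) ^ (3 + 2) * (wH (N := Lc ^ (j + 1)) κ l (z + Pi.single ν 1) - wH (N := Lc ^ (j + 1)) κ l z)| ≤
        CH' / (Lc : ℝ) ^ (j + 1) * Real.exp (-δ * l1 (quo (Lc ^ (j + 1)) z)))
    (hNC : ∀ (j : ℕ) (κ l : Fin (3 + 1)) (z : Fin (3 + 1) → ℤ),
      |((Lc : ℝ) ^ (j + 1 + 1)) ^ (3 + 2) * wH (N := Lc ^ (j + 1 + 1)) κ l z -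
          ((Lc : ℝ) ^ (j + 1)) ^ (3 + 2) * wH (N := Lc ^ (j + 1)) κ l (quo Lc z)| ≤
        cC * θC ^ j * Real.exp (-δ * l1 (quo (Lc ^ (j + 1 + 1)) z)))
    (n : ℕ) (κ' : Fin (3 + 1)) (u' x z : Fin (3 + 1) → ℤ) (a b : Fib 3) :
    |((Lc : ℝ) ^ (n + 1 + 1 + 1)) ^ (2 * (3 + 1)) * e3OfS (Lc ^ (n + 1 + 1 + 1))
        (fun κ u => (cE * ((Lc : ℝ) ^ (3 + 1)) ^ (n + 1 + 1)) • wilsonA 3 κ u) κ' u' x z a b -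
      ((Lc : ℝ) ^ (n + 1 + 1)) ^ (2 * (3 + 1)) * e3OfS (Lc ^ (n + 1 + 1))
        (fun κ u => (cE * ((Lc : ℝ) ^ (3 + 1)) ^ (n + 1)) • wilsonA 3 κ u) κ' u' x z a b| ≤
      |cE / (Lc : ℝ) ^ (3 + 1)| * ((((3 : ℕ) : ℝ) + 1) ^ 3 * ((box1 (3 + 1)).card : ℝ) ^ 2 * wBound 3 * Zl (3 + 1) (δ / 2)) *
        (cC * θC ^ (n + 1) *
          ((4 : ℕ) * Real.exp (3 * δ * (4 : ℕ)) * (CH' * CH + 2 * CH * CH') + (4 : ℕ) * Real.exp (2 * δ * (4 : ℕ)) *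
            ((Lc * CH') * CH + CH * CH') + (4 : ℕ) * Real.exp (3 * δ * (4 : ℕ)) * ((Lc * CH') * CH + 2 * CH * (Lc * CH'))) +
         (1 / (Lc : ℝ) ^ (n + 1 + 1)) * (((Lc : ℝ) + 1) * (4 : ℕ) ^ 2 * Real.exp (2 * δ * (4 : ℕ)) *
           ((CH' * CH + CH * CH') * CH' + (CH' * CH + CH * CH') * CH' + CH * CH' * CH'))) := by
  have hL : (0 : ℝ) < Lc := by exact_mod_cast Nat.pos_of_ne_zero (NeZero.ne Lc)
  have hcast0 : ((Lc ^ (n + 1 + 1) : ℕ) : ℝ) = (Lc : ℝ) ^ (n + 1 + 1) := by push_cast; rfl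
  have hcast1 : ((Lc ^ (n + 1 + 1 + 1) : ℕ) : ℝ) = (Lc : ℝ) ^ (n + 1 + 1 + 1) := by push_cast; rfl
  have hre : ∀ c A B : ℝ, c * -A - c * -B = -(c * (A - B)) := fun c A B => by ring
  have hsm : ((Lc ^ (n + 1 + 1 + 1) : ℕ) : ℤ) • u' = (Lc : ℤ) • (((Lc ^ (n + 1 + 1) : ℕ) : ℤ) • u') := by
    rw [smul_smul]; congr 1; push_cast; ring
  have hqL : ∀ v t : Fin (3 + 1) → ℤ, quo Lc (v - ((Lc ^ (n + 1 + 1 + 1) : ℕ) : ℤ) • t) =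
      quo Lc v - ((Lc ^ (n + 1 + 1) : ℕ) : ℤ) • t := by
    intro v t
    rw [show ((Lc ^ (n + 1 + 1 + 1) : ℕ) : ℤ) • t = (Lc : ℤ) • (((Lc ^ (n + 1 + 1) : ℕ) : ℤ) • t) by
      rw [smul_smul]; congr 1; push_cast; ring, sub_eq_add_neg, ← smul_neg, quo_add_zsmul, ← sub_eq_add_neg]
  -- nonnegativity of the displayed bound (for the vanishing entries)
  have hCH : 0 ≤ CH := TaylorTrilinear.nonneg_of_abs_le_mul_exp hδ.le (l1_nonneg _) (hN1 0 0 0 0)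
  have hwB := wBound_nonneg 3
  have hZ : 0 ≤ Zl (3 + 1) (δ / 2) := tsum_nonneg fun _ => (Real.exp_pos _).le
  have hRHS : 0 ≤ |cE / (Lc : ℝ) ^ (3 + 1)| * ((((3 : ℕ) : ℝ) + 1) ^ 3 * ((box1 (3 + 1)).card : ℝ) ^ 2 * wBound 3 * Zl (3 + 1) (δ / 2)) *
        (cC * θC ^ (n + 1) *
          ((4 : ℕ) * Real.exp (3 * δ * (4 : ℕ)) * (CH' * CH + 2 * CH * CH') + (4 : ℕ) * Real.exp (2 * δ * (4 : ℕ)) *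
            ((Lc * CH') * CH + CH * CH') + (4 : ℕ) * Real.exp (3 * δ * (4 : ℕ)) * ((Lc * CH') * CH + 2 * CH * (Lc * CH'))) +
         (1 / (Lc : ℝ) ^ (n + 1 + 1)) * (((Lc : ℝ) + 1) * (4 : ℕ) ^ 2 * Real.exp (2 * δ * (4 : ℕ)) *
           ((CH' * CH + CH * CH') * CH' + (CH' * CH + CH * CH') * CH' + CH * CH' * CH'))) := by positivity
  rcases a with α | μ
  swap
  · rw [e3OfS_inr, e3OfS_inr, mul_zero, mul_zero, sub_zero, abs_zero]; exact hRHS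
  rcases b with β | ν
  swap
  · rw [e3OfS_inl_inr, e3OfS_inl_inr, mul_zero, mul_zero, sub_zero, abs_zero]; exact hRHS
  -- the two entries through `e3W_unit_split` (residual `1` at `d = 3`)
  have e0 : ((Lc : ℝ) ^ (n + 1 + 1)) ^ (((3 : ℕ) : ℤ) - 3) = 1 := by norm_num
  have e1 : ((Lc : ℝ) ^ (n + 1 + 1 + 1)) ^ (((3 : ℕ) : ℤ) - 3) = 1 := by norm_num
  have h0 := e3W_unit_split (d := 3) (Lc := Lc) cE (n + 1) κ' u' x z α β
  have h1 := e3W_unit_split (d := 3) (Lc := Lc) cE (n + 1 + 1) κ' u' x z α β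
  rw [e0, mul_one] at h0
  rw [e1, mul_one] at h1
  rw [h0, h1, ← mul_sub, abs_mul, abs_neg, mul_assoc (|cE / (Lc : ℝ) ^ (3 + 1)|)]
  refine mul_le_mul_of_nonneg_left ?_ (abs_nonneg _)
  -- the generic two-level bound, instantiated
  have hB := trilinear_diff_bound (d := 3) (Lc ^ (n + 1 + 1)) Lc (Lc ^ (n + 1 + 1 + 1))
    (fun l w => ((Lc : ℝ) ^ (n + 1 + 1)) ^ (3 + 2) * GamΦ (N := Lc ^ (n + 1 + 1)) α x l w)
    (fun l' y => ((Lc : ℝ) ^ (n + 1 + 1)) ^ (3 + 2) * wH (N := Lc ^ (n + 1 + 1)) l' β (y - ((Lc ^ (n + 1 + 1) : ℕ) : ℤ) • z))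
    (fun κ u => ((Lc : ℝ) ^ (n + 1 + 1)) ^ (3 + 2) * wH (N := Lc ^ (n + 1 + 1)) κ κ' (u - ((Lc ^ (n + 1 + 1) : ℕ) : ℤ) • u'))
    (fun l w => ((Lc : ℝ) ^ (n + 1 + 1 + 1)) ^ (3 + 2) * GamΦ (N := Lc ^ (n + 1 + 1 + 1)) α x l w)
    (fun l' y => ((Lc : ℝ) ^ (n + 1 + 1 + 1)) ^ (3 + 2) *
      wH (N := Lc ^ (n + 1 + 1 + 1)) l' β (y - ((Lc ^ (n + 1 + 1 + 1) : ℕ) : ℤ) • z))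
    (fun κ u => ((Lc : ℝ) ^ (n + 1 + 1 + 1)) ^ (3 + 2) *
      wH (N := Lc ^ (n + 1 + 1 + 1)) κ κ' (u - ((Lc ^ (n + 1 + 1 + 1) : ℕ) : ℤ) • u'))
    (fun κ u w y l l' => wilsonA 3 κ u w y (Sum.inl l) (Sum.inl l')) (box1 (3 + 1)) x z u'
    (CG := CH) (CG' := CH') (CK := CH) (CK' := CH') (CH := CH) (CH' := CH') (C₁K := CH) (C₁K' := CH') (C₁H := CH) (C₁H' := CH')
    (εG := cC * θC ^ (n + 1)) (εK := cC * θC ^ (n + 1)) (εH := cC * θC ^ (n + 1)) (CT := wBound 3) (R := 3 + 1)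
    (by rw [pow_succ, mul_comm]) hδ hCH' hCH' hCH' hCH' hCH' ?_ ?_ ?_ ?_ ?_ ?_ ?_ ?_ ?_ ?_ ?_ ?_ ?_ ?_ ?_ ?_ ?_ ?_ ?_
  · -- the bound, with the casts of the two blockings as real powers and `E ≤ 1`
    rw [hcast0, hcast1] at hB
    refine hB.trans ?_
    have hE : Real.exp (-(δ / 2) * (l1 (x - u') + l1 (z - u'))) ≤ 1 :=
      Real.exp_le_one_iff.2 (by nlinarith [l1_nonneg (x - u'), l1_nonneg (z - u')])
    have hP : 0 ≤ (((3 : ℕ) : ℝ) + 1) ^ 3 * ((box1 (3 + 1)).card : ℝ) ^ 2 * wBound 3 * Zl (3 + 1) (δ / 2) := by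
      have := wBound_nonneg 3
      have hZ : 0 ≤ Zl (3 + 1) (δ / 2) := tsum_nonneg fun _ => (Real.exp_pos _).le
      positivity
    have hX : 0 ≤ cC * θC ^ (n + 1) *
          ((4 : ℕ) * Real.exp (3 * δ * (4 : ℕ)) * (CH' * CH + 2 * CH * CH') + (4 : ℕ) * Real.exp (2 * δ * (4 : ℕ)) *
            ((Lc * CH') * CH + CH * CH') + (4 : ℕ) * Real.exp (3 * δ * (4 : ℕ)) * ((Lc * CH') * CH + 2 * CH * (Lc * CH'))) +
         (1 / (Lc : ℝ) ^ (n + 1 + 1)) * (((Lc : ℝ) + 1) * (4 : ℕ) ^ 2 * Real.exp (2 * δ * (4 : ℕ)) *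
           ((CH' * CH + CH * CH') * CH' + (CH' * CH + CH * CH') * CH' + CH * CH' * CH')) := by positivity
    calc _ ≤ ((((3 : ℕ) : ℝ) + 1) ^ 3 * ((box1 (3 + 1)).card : ℝ) ^ 2 * wBound 3 * Zl (3 + 1) (δ / 2)) *
          (cC * θC ^ (n + 1) *
            ((4 : ℕ) * Real.exp (3 * δ * (4 : ℕ)) * (CH' * CH + 2 * CH * CH') + (4 : ℕ) * Real.exp (2 * δ * (4 : ℕ)) *
              ((Lc * CH') * CH + CH * CH') + (4 : ℕ) * Real.exp (3 * δ * (4 : ℕ)) * ((Lc * CH') * CH + 2 * CH * (Lc * CH'))) +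
           (1 / (Lc : ℝ) ^ (n + 1 + 1)) * (((Lc : ℝ) + 1) * (4 : ℕ) ^ 2 * Real.exp (2 * δ * (4 : ℕ)) *
             ((CH' * CH + CH * CH') * CH' + (CH' * CH + CH * CH') * CH' + CH * CH' * CH'))) * 1 := by
          refine mul_le_mul (le_of_eq ?_) hE (Real.exp_pos _).le (mul_nonneg hP hX)
          push_cast; ring
      _ = _ := by rw [mul_one]
  · -- (hG)
    intro l w
    rw [GamΦ_eq_neg_wH, mul_neg, abs_neg, ← quo_sub_zsmul (N := Lc ^ (n + 1 + 1)) w x]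
    exact hN1 (n + 1) l α _
  · -- (hG′)
    intro l w ν
    rw [GamΦ_eq_neg_wH, GamΦ_eq_neg_wH, hre, abs_neg, hcast0, ← quo_sub_zsmul (N := Lc ^ (n + 1 + 1)) w x, add_sub_right_comm]
    exact hN1' (n + 1) l α _ ν
  · -- (hK)
    intro l y
    rw [← quo_sub_zsmul (N := Lc ^ (n + 1 + 1)) y z]
    exact hN1 (n + 1) l β _
  · -- (hK′)
    intro l y ν
    rw [← mul_sub, hcast0, ← quo_sub_zsmul (N := Lc ^ (n + 1 + 1)) y z, add_sub_right_comm]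
    exact hN1' (n + 1) l β _ ν
  · -- (hH)
    intro κ u
    rw [← quo_sub_zsmul (N := Lc ^ (n + 1 + 1)) u u']
    exact hN1 (n + 1) κ κ' _
  · -- (hH′)
    intro κ u ν
    rw [← mul_sub, hcast0, ← quo_sub_zsmul (N := Lc ^ (n + 1 + 1)) u u', add_sub_right_comm]
    exact hN1' (n + 1) κ κ' _ ν
  · -- (hK₁)
    intro l y
    rw [← quo_sub_zsmul (N := Lc ^ (n + 1 + 1 + 1)) y z]
    exact hN1 (n + 1 + 1) l β _
  · -- (hK₁′)
    intro l y ν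
    rw [← mul_sub, hcast1, ← quo_sub_zsmul (N := Lc ^ (n + 1 + 1 + 1)) y z, add_sub_right_comm]
    exact hN1' (n + 1 + 1) l β _ ν
  · -- (hH₁)
    intro κ u
    rw [← quo_sub_zsmul (N := Lc ^ (n + 1 + 1 + 1)) u u']
    exact hN1 (n + 1 + 1) κ κ' _
  · -- (hH₁′)
    intro κ u ν
    rw [← mul_sub, hcast1, ← quo_sub_zsmul (N := Lc ^ (n + 1 + 1 + 1)) u u', add_sub_right_comm]
    exact hN1' (n + 1 + 1) κ κ' _ ν
  · -- (hGc): the coupling on the row leg (minus the column leg)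
    intro l w
    have h := hNC (n + 1) l α (w - ((Lc ^ (n + 1 + 1 + 1) : ℕ) : ℤ) • x)
    rw [hqL, quo_sub_zsmul] at h
    rw [GamΦ_eq_neg_wH, GamΦ_eq_neg_wH, mul_neg, mul_neg, neg_sub_neg, abs_sub_comm]
    exact h
  · -- (hKc)
    intro l y
    have h := hNC (n + 1) l β (y - ((Lc ^ (n + 1 + 1 + 1) : ℕ) : ℤ) • z)
    rw [hqL, quo_sub_zsmul] at h
    exact h
  · -- (hHc)
    intro κ u
    have h := hNC (n + 1) κ κ' (u - ((Lc ^ (n + 1 + 1 + 1) : ℕ) : ℤ) • u')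
    rw [hqL, quo_sub_zsmul] at h
    exact h
  · -- (hB)
    intro s hs
    exact natl1_le_of_mem_box1 hs
  · intro κ v w y l l'; exact abs_wilsonA_le κ v w y _ _
  · intro κ v w y l l' hw; exact wilsonA_eq_zero_of_left κ v w y l l' hw
  · intro κ v w y l l' hy; exact wilsonA_eq_zero_of_right κ v w y l l' hy
  · intro κ v l l'; exact wilsonA_sum_zero_offsets κ v l l'
  · intro κ v s t l l'; exact wilsonA_tinv κ v s t l l'

end Row

/-! ## §3 Row dW packaged: `∃ cW θ, 0 ≤ θ < 1 ∧ dW` (the RATE END's binder VERBATIM at `d = 3`), modulo (N1)∕(N1′)∕(N1-Cauchy) -/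

section Packaged

variable {Lc : ℕ} [NeZero Lc]

omit [NeZero Lc] in
/-- [folklore] Geometric packaging: `a·θ_C^{n+1} + Lc^{-(n+2)}·b ≤ (a + b/Lc)·(max θ_C Lc⁻¹)^{n+1}`. -/
theorem geom_pack {θC a b : ℝ} (hθC : 0 ≤ θC) (ha : 0 ≤ a) (hb : 0 ≤ b) (hL : 0 < (Lc : ℝ)) (n : ℕ) :
    a * θC ^ (n + 1) + 1 / (Lc : ℝ) ^ (n + 1 + 1) * b ≤ (a + b / Lc) * (max θC (1 / (Lc : ℝ))) ^ (n + 1) := by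
  have h1 : θC ^ (n + 1) ≤ (max θC (1 / (Lc : ℝ))) ^ (n + 1) := pow_le_pow_left₀ hθC (le_max_left _ _) _
  have h2 : (1 / (Lc : ℝ)) ^ (n + 1) ≤ (max θC (1 / (Lc : ℝ))) ^ (n + 1) :=
    pow_le_pow_left₀ (by positivity) (le_max_right _ _) _
  have e : 1 / (Lc : ℝ) ^ (n + 1 + 1) * b = b / Lc * (1 / (Lc : ℝ)) ^ (n + 1) := by
    rw [one_div_pow, pow_succ]; field_simp
  rw [e, add_mul]
  have hbL : 0 ≤ b / Lc := div_nonneg hb hL.le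
  nlinarith [mul_le_mul_of_nonneg_left h1 ha, mul_le_mul_of_nonneg_left h2 hbL]

/-- [folklore] **ROW dW MODULO (N1)∕(N1′)∕(N1-Cauchy)** (the RATE END's binder `dW` VERBATIM at `d = 3`, as `∃ cW θ, 0 ≤ θ ∧ θ < 1 ∧ …`;
`Lc ≥ 2`, `θ = max θ_C Lc⁻¹`, `cW = |cE/Lc⁴|·P·(c_C·X_I + X_II/Lc)`). -/
theorem rowDW_of_fineReadout (hLc : 2 ≤ Lc) (cE : ℝ) {δ CH CH' cC θC : ℝ} (hδ : 0 < δ) (hCH' : 0 ≤ CH') (hcC : 0 ≤ cC)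
    (hθC0 : 0 ≤ θC) (hθC1 : θC < 1)
    (hN1 : ∀ (j : ℕ) (κ l : Fin (3 + 1)) (z : Fin (3 + 1) → ℤ),
      |((Lc : ℝ) ^ (j + 1)) ^ (3 + 2) * wH (N := Lc ^ (j + 1)) κ l z| ≤ CH * Real.exp (-δ * l1 (quo (Lc ^ (j + 1)) z)))
    (hN1' : ∀ (j : ℕ) (κ l : Fin (3 + 1)) (z : Fin (3 + 1) → ℤ) (ν : Fin (3 + 1)),
      |((Lc : ℝ) ^ (j + 1)) ^ (3 + 2) * (wH (N := Lc ^ (j + 1)) κ l (z + Pi.single ν 1) - wH (N := Lc ^ (j + 1)) κ l z)| ≤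
        CH' / (Lc : ℝ) ^ (j + 1) * Real.exp (-δ * l1 (quo (Lc ^ (j + 1)) z)))
    (hNC : ∀ (j : ℕ) (κ l : Fin (3 + 1)) (z : Fin (3 + 1) → ℤ),
      |((Lc : ℝ) ^ (j + 1 + 1)) ^ (3 + 2) * wH (N := Lc ^ (j + 1 + 1)) κ l z -
          ((Lc : ℝ) ^ (j + 1)) ^ (3 + 2) * wH (N := Lc ^ (j + 1)) κ l (quo Lc z)| ≤
        cC * θC ^ j * Real.exp (-δ * l1 (quo (Lc ^ (j + 1 + 1)) z))) :
    ∃ cW θ : ℝ, 0 ≤ θ ∧ θ < 1 ∧ ∀ (n : ℕ) (κ' : Fin (3 + 1)) (u' : Fin (3 + 1) → ℤ), SupBound (fun x z a b =>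
      ((Lc : ℝ) ^ (n + 1 + 1 + 1)) ^ (2 * (3 + 1)) * e3OfS (Lc ^ (n + 1 + 1 + 1))
          (fun κ u => (cE * ((Lc : ℝ) ^ (3 + 1)) ^ (n + 1 + 1)) • wilsonA 3 κ u) κ' u' x z a b -
        ((Lc : ℝ) ^ (n + 1 + 1)) ^ (2 * (3 + 1)) * e3OfS (Lc ^ (n + 1 + 1))
          (fun κ u => (cE * ((Lc : ℝ) ^ (3 + 1)) ^ (n + 1)) • wilsonA 3 κ u) κ' u' x z a b) (cW * θ ^ (n + 1)) := by
  have hL : (0 : ℝ) < Lc := by exact_mod_cast Nat.pos_of_ne_zero (NeZero.ne Lc)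
  have hL2 : (2 : ℝ) ≤ Lc := by exact_mod_cast hLc
  have hCH : 0 ≤ CH := TaylorTrilinear.nonneg_of_abs_le_mul_exp hδ.le (l1_nonneg _) (hN1 0 0 0 0)
  have hwB := wBound_nonneg 3
  have hZ : 0 ≤ Zl (3 + 1) (δ / 2) := tsum_nonneg fun _ => (Real.exp_pos _).le
  set XI : ℝ := (4 : ℕ) * Real.exp (3 * δ * (4 : ℕ)) * (CH' * CH + 2 * CH * CH') + (4 : ℕ) * Real.exp (2 * δ * (4 : ℕ)) *
    ((Lc * CH') * CH + CH * CH') + (4 : ℕ) * Real.exp (3 * δ * (4 : ℕ)) * ((Lc * CH') * CH + 2 * CH * (Lc * CH')) with hXI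
  set XII : ℝ := ((Lc : ℝ) + 1) * (4 : ℕ) ^ 2 * Real.exp (2 * δ * (4 : ℕ)) *
    ((CH' * CH + CH * CH') * CH' + (CH' * CH + CH * CH') * CH' + CH * CH' * CH') with hXII
  set P : ℝ := |cE / (Lc : ℝ) ^ (3 + 1)| * ((((3 : ℕ) : ℝ) + 1) ^ 3 * ((box1 (3 + 1)).card : ℝ) ^ 2 * wBound 3 *
    Zl (3 + 1) (δ / 2)) with hP
  have hXI0 : 0 ≤ XI := by rw [hXI]; positivity
  have hXII0 : 0 ≤ XII := by rw [hXII]; positivity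
  have hP0 : 0 ≤ P := by rw [hP]; positivity
  refine ⟨P * (cC * XI + XII / Lc), max θC (1 / (Lc : ℝ)), le_max_of_le_left hθC0,
    max_lt hθC1 (by rw [div_lt_one hL]; linarith), fun n κ' u' x z a b => ?_⟩
  have h := abs_wilson_diff_entry_le cE hδ hCH' hcC hθC0 hN1 hN1' hNC n κ' u' x z a b
  rw [← hXI, ← hXII, ← hP] at h
  refine h.trans ?_
  rw [mul_assoc P]
  refine mul_le_mul_of_nonneg_left ?_ hP0
  have := geom_pack (Lc := Lc) hθC0 (mul_nonneg hcC hXI0) hXII0 hL n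
  calc cC * θC ^ (n + 1) * XI + 1 / (Lc : ℝ) ^ (n + 1 + 1) * XII
      = (cC * XI) * θC ^ (n + 1) + 1 / (Lc : ℝ) ^ (n + 1 + 1) * XII := by ring
    _ ≤ (cC * XI + XII / Lc) * (max θC (1 / (Lc : ℝ))) ^ (n + 1) := this

/-- [folklore] Rate weakening of a block-label bound. -/
theorem weaken_rate {v C δ δ' r : ℝ} (hC : 0 ≤ C) (hr : 0 ≤ r) (hδ : δ' ≤ δ) (h : |v| ≤ C * Real.exp (-δ * r)) :
    |v| ≤ C * Real.exp (-δ' * r) :=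
  h.trans (mul_le_mul_of_nonneg_left (Real.exp_le_exp.2 (by nlinarith)) hC)

/-- NOT IN PRINT; OUR PROOF.  **ROW dW OF THE RATE TABLE AT `d = 3`, MODULO «(N1-Cauchy)» ONLY** (LEAVES.md PART III § III.R row
R3-dW; the hypothesis `dW` of the row owner's RATE END `StencilSlotE3RateOfPieces.e3SupRate_of_pieces` VERBATIM at `d = 3`, delivered as
`∃ cW θ, 0 ≤ θ ∧ θ < 1 ∧ ∀ n κ′ u′, SupBound (…) (cW·θ^{n+1})`): for every blocking factor `Lc ≥ 2` and every Wilson coefficient `cE`,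
GIVEN the located one-step convergence of the normalised minimiser column in the POINTWISE-SAMPLE block-label `ℓ¹` form
`|H̃_{Lc^{j+2}} κ l z − H̃_{Lc^{j+1}} κ l (quo Lc z)| ≤ c_C·θ_C^j·e^{−δ_C|quo_{Lc^{j+2}} z|₁}` (the owner's `N1-CAUCHY-SPEC.md` §1 gives the
cell-mean ∕ sup-norm form; equivalent given (N1′) — the adapter is the consumer's), the depth-paired one-step difference of the
Wilson pieces of the normalised third jet is `≤ cW·θ^{n+1}`, `θ < 1`.  Inputs BY NAME: (N1) ∧ (N1′)
`FineReadoutGradientDecay.exists_wH_decay_and_grad` (leaf-16 ∕ leaf-19) through the currency adapters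
`TaylorRowW.legBound_of_supNorm_form` ∕ `legGrad_of_supNorm_form`, the unit split `E3UnitSplit.e3W_unit_split` (leaf-01), W1
(leaf-15) through `TaylorRowW.wilsonA_sum_zero_offsets`, `ResolventComposition.GamΦ_eq_neg_wH` (an5), and the generic two-level engine
`TaylorTrilinearDiff.trilinear_diff_bound` (this lineage).  ONE of twelve analytic rows, CONDITIONAL on «(N1-Cauchy)» (OPEN, typer row
T-N1C); discharges NOTHING of (hS, hSall) by itself; NOT BetaPertH, NOT continuum, NOT Clay. -/
theorem rowDW_of_cauchy (hLc : 2 ≤ Lc) (cE : ℝ) {δC cC θC : ℝ} (hδC : 0 < δC) (hcC : 0 ≤ cC) (hθC0 : 0 ≤ θC) (hθC1 : θC < 1)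
    (hNC : ∀ (j : ℕ) (κ l : Fin (3 + 1)) (z : Fin (3 + 1) → ℤ),
      |((Lc : ℝ) ^ (j + 1 + 1)) ^ (3 + 2) * wH (N := Lc ^ (j + 1 + 1)) κ l z -
          ((Lc : ℝ) ^ (j + 1)) ^ (3 + 2) * wH (N := Lc ^ (j + 1)) κ l (quo Lc z)| ≤
        cC * θC ^ j * Real.exp (-δC * l1 (quo (Lc ^ (j + 1 + 1)) z))) :
    ∃ cW θ : ℝ, 0 ≤ θ ∧ θ < 1 ∧ ∀ (n : ℕ) (κ' : Fin (3 + 1)) (u' : Fin (3 + 1) → ℤ), SupBound (fun x z a b =>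
      ((Lc : ℝ) ^ (n + 1 + 1 + 1)) ^ (2 * (3 + 1)) * e3OfS (Lc ^ (n + 1 + 1 + 1))
          (fun κ u => (cE * ((Lc : ℝ) ^ (3 + 1)) ^ (n + 1 + 1)) • wilsonA 3 κ u) κ' u' x z a b -
        ((Lc : ℝ) ^ (n + 1 + 1)) ^ (2 * (3 + 1)) * e3OfS (Lc ^ (n + 1 + 1))
          (fun κ u => (cE * ((Lc : ℝ) ^ (3 + 1)) ^ (n + 1)) • wilsonA 3 κ u) κ' u' x z a b) (cW * θ ^ (n + 1)) := by
  obtain ⟨κ₀, C, C', hκ₀, hC, hC', hN1, hN1'⟩ := FineReadoutGradientDecay.exists_wH_decay_and_grad (Lc := Lc)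
  have h1 := TaylorRowW.legBound_of_supNorm_form (d := 3) hκ₀.le hN1
  have h1' := TaylorRowW.legGrad_of_supNorm_form (d := 3) hκ₀.le hN1'
  have hδ₁ : (0 : ℝ) < κ₀ / ((3 : ℕ) + 1) := by positivity
  -- common rate `min (κ₀/4) δC`
  exact rowDW_of_fineReadout hLc cE (δ := min (κ₀ / ((3 : ℕ) + 1)) δC) (lt_min hδ₁ hδC) hC' hcC hθC0 hθC1
    (fun j κ l z => weaken_rate hC (l1_nonneg _) (min_le_left _ _) (h1 j κ l z))
    (fun j κ l z ν => weaken_rate (by positivity) (l1_nonneg _) (min_le_left _ _) (h1' j κ l z ν))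
    (fun j κ l z => weaken_rate (by positivity) (l1_nonneg _) (min_le_right _ _) (hNC j κ l z))

/-- [folklore] The coordinatewise reduction modulo `Lc` has `ℓ¹` size at most `(d+1)·Lc`. -/
theorem l1_red_le (Lc : ℕ) [NeZero Lc] (w : Fin (d + 1) → ℤ) : l1 (LatticeForm.red Lc w) ≤ ((d : ℝ) + 1) * Lc := by
  have hL : (0 : ℤ) < Lc := by exact_mod_cast Nat.pos_of_ne_zero (NeZero.ne Lc)
  unfold l1
  calc ∑ j, |((LatticeForm.red Lc w j : ℤ) : ℝ)| ≤ ∑ _j : Fin (d + 1), (Lc : ℝ) := Finset.sum_le_sum fun j _ => by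
          have h0 : 0 ≤ w j % (Lc : ℤ) := Int.emod_nonneg _ hL.ne'
          have h1 : w j % (Lc : ℤ) < Lc := Int.emod_lt_of_pos _ hL
          have h0' : (0 : ℝ) ≤ ((w j % (Lc : ℤ) : ℤ) : ℝ) := by exact_mod_cast h0
          have h1' : ((w j % (Lc : ℤ) : ℤ) : ℝ) ≤ Lc := by exact_mod_cast h1.le
          simp only [LatticeForm.red]
          rw [abs_of_nonneg h0']; exact h1'
    _ = ((d : ℝ) + 1) * Lc := by simp [Finset.sum_const, Finset.card_univ, Fintype.card_fin]

/-- NOT IN PRINT; OUR PROOF.  **ROW dW FROM THE SAMPLE FORM OF «(N1-Cauchy)»** (socket for leaf-19's adapter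
`FineReadoutCauchyDecLegs.exists_sample_cauchy_of_cellMean` (P): «every sample of the level-`n+2` normalised column within
`2(d+1)Lc` of the cell corner `Lc•z` is within `c′θ′^n e^{−κ′|quo z|₁}` of the level-`n+1` column at `z`»): the pointwise-sample
coupling `hNC` of `rowDW_of_cauchy` is (P) at `z := quo Lc w`, `v := red Lc w` (`red_add_smul_quo`, `ScaleNesting.quo_mul`), so row dW
follows from (P) alone — (N1) ∧ (N1′) BY NAME inside.  Conditional on «(N1-Cauchy)» (cell-mean form ⟹ (P) is leaf-19's tree lemma);
NOT BetaPertH, NOT continuum, NOT Clay. -/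
theorem rowDW_of_sampleCauchy (hLc : 2 ≤ Lc) (cE : ℝ) {κC cC θC : ℝ} (hκC : 0 < κC) (hcC : 0 ≤ cC) (hθC0 : 0 ≤ θC) (hθC1 : θC < 1)
    (hP : ∀ (n : ℕ) (κ l : Fin (3 + 1)) (z v : Fin (3 + 1) → ℤ), l1 v ≤ 2 * ((3 : ℝ) + 1) * Lc →
      |((Lc : ℝ) ^ (n + 1 + 1)) ^ (3 + 2) * wH (N := Lc ^ (n + 1 + 1)) κ l ((Lc : ℤ) • z + v) -
          ((Lc : ℝ) ^ (n + 1)) ^ (3 + 2) * wH (N := Lc ^ (n + 1)) κ l z| ≤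
        cC * θC ^ n * Real.exp (-κC * l1 (quo (Lc ^ (n + 1)) z))) :
    ∃ cW θ : ℝ, 0 ≤ θ ∧ θ < 1 ∧ ∀ (n : ℕ) (κ' : Fin (3 + 1)) (u' : Fin (3 + 1) → ℤ), SupBound (fun x z a b =>
      ((Lc : ℝ) ^ (n + 1 + 1 + 1)) ^ (2 * (3 + 1)) * e3OfS (Lc ^ (n + 1 + 1 + 1))
          (fun κ u => (cE * ((Lc : ℝ) ^ (3 + 1)) ^ (n + 1 + 1)) • wilsonA 3 κ u) κ' u' x z a b -
        ((Lc : ℝ) ^ (n + 1 + 1)) ^ (2 * (3 + 1)) * e3OfS (Lc ^ (n + 1 + 1))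
          (fun κ u => (cE * ((Lc : ℝ) ^ (3 + 1)) ^ (n + 1)) • wilsonA 3 κ u) κ' u' x z a b) (cW * θ ^ (n + 1)) := by
  refine rowDW_of_cauchy hLc cE hκC hcC hθC0 hθC1 fun j κ l w => ?_
  have hdec : (Lc : ℤ) • quo Lc w + LatticeForm.red Lc w = w := (add_comm _ _).trans (LatticeForm.red_add_smul_quo Lc w)
  have hv : l1 (LatticeForm.red Lc w) ≤ 2 * ((3 : ℝ) + 1) * Lc := by
    have h := l1_red_le Lc w
    have hL : (0 : ℝ) ≤ Lc := by positivity
    push_cast at h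
    nlinarith
  have h := hP j κ l (quo Lc w) (LatticeForm.red Lc w) hv
  rw [hdec, ← ScaleNesting.quo_mul, ← pow_succ'] at h
  exact h

end Packaged




end Summit.QuantumFields.BalabanUV.Beta.GAN24.TaylorRowDW

end
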